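import Summits.BirchSwinnertonDyer.BirchSwinnertonDyer.Theorems.ResidualThetaTransportAtTwoThetaLayerLambdaCongruenceAtTwoCuspSpanPrimePowNode
import Summits.BirchSwinnertonDyer.BirchSwinnertonDyer.Theorems.ResidualThetaTransportAtTwoThetaLayerLambdaCongruenceAtTwoCuspSpanFourInvarianceOdd
import Mathlib.Data.Nat.ChineseRemainder
import HarnessLib

/-!
# Route `ResidualThetaTransportAtTwo`, cruxes Kan⁺ (stmt-BirchSwinnertonDyer-20688) / node 27436 / 21437: at EVERY ODD LEVEL `N` the
# `B₁`-character of an admissible `χ` is MULTIPLICATIVE; the node (G′)_N is equivalent to «admissible `χ` vanishing on `B₁` vanish»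

Cell `bsd-wall`, width seat `bsd-wall-rtt-p3-w4` g2 (2026-08-28), lane «3-fold B₁-products at prime-power and composite level».
THEOREMS ONLY; `--supports stmt-BirchSwinnertonDyer-20688`; BSD is not proved by this. Inputs by name: the level-`N` three-fold relation
`TriangleN.chi_add_chi_add_chi_eq_zero_levelN` (this seat, p636849; device of `rtt-p3-w2` g4) and `rtt-p3-w5` g2's two-fold products
at every odd level (`…CuspSpanFourInvarianceOdd`: `F(4^j u) = F(u)`, `F(1/u) = F(u)`, `F(−u) = F(u)`).

Let `N` be odd, `χ : Γ₀(N) → 𝔽₂` ADMISSIBLE (additive, killing the elements of trace `0, ±1, ±2` and those with lower-right entry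
`±4^k`, `k ≥ 1`), `F(u) := χ(β)` for `b = −1` elements `β` with `d(β) ≡ u`.
* §1 `TriangleN.exists_coprime_avoiding` — CRT: a unit `g` with `g ≢ 0, 1, c (mod ℓ)` for every prime `ℓ ∣ N` (`c ≢ 2 (mod 3)` if `3 ∣ N`).
* §2 `chi_add_chi_add_chi_eq_zero_odd_of_ne_one` — `F(uv) = F(u) + F(v)` when `u ≢ 1` modulo every prime of `N`
  (the level-`N` relation gives `F(u) + F(v) + F(4^K/(uv)) = 0`, and `F(4^K/(uv)) = F(1/(uv)) = F(uv)`).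
* §3 `chi_add_chi_add_chi_eq_zero_odd` — **`F(uv) = F(u) + F(v)` for ALL units**: with `g` from §1 (`c = v`, after `v ↦ −v` if
  `v ≡ 2 (mod 3)`), `F(v) = F(g) + F(v/g)`, `F(uv) = F(g) + F(uv/g)`, `F(uv/g) = F(v/g) + F(u)` (§2 for `g` and for `v/g`).
* §4 `cuspSpanEvenAtTwo_of_forall_b1_odd` — **(G′)_N ⟸ (G‴)_N** «every admissible `χ` vanishing on `B₁` vanishes identically»:
  `χ + F ∘ d̄` is admissible (small trace: `d = ±(1 + ε)`, `ε² = 0`, `F(1+ε) = F((1+ε)^N) = 0`; elliptic seed; `F(±4^k) = 0`) and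
  vanishes on `B₁`; and the converse `forall_b1_of_cuspSpanEvenAtTwo`. So at composite `N` the node is EXACTLY the generation
  statement (G‴)_N (at prime powers (G‴) is the (SUCC) descent — `…CuspSpanPrimePowNode`).
References: [Rademacher1929] §1; [Knapp1993] Prop. 11.1; [Pollack2003] Conj. 6.3; [IrelandRosen1990] Ch. 3–4 (CRT). -/

set_option autoImplicit false
set_option linter.dupNamespace false

noncomputable section

open scoped MatrixGroups Function

open CongruenceSubgroup

namespace Summit.BirchSwinnertonDyer.BirchSwinnertonDyer.Theorems.SignedMuAtTwo

variable {N : ℕ} {χ : Gamma0 N → ZMod 2}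

/-! ## §1. A unit avoiding `0, 1, c` modulo every prime of `N` -/

omit χ in
/-- **CRT auxiliary unit.** For odd `N` and an integer `c` with `c ≢ 2 (mod 3)` if `3 ∣ N`: a natural number `g` prime to `N` with
`g ≢ 0, 1, c (mod ℓ)` for every prime `ℓ ∣ N` (`g ≡ 2`, or `g ≡ 3` where `c ≡ 2`). [cite: IrelandRosen1990, Ch. 3] -/
theorem TriangleN.exists_coprime_avoiding (hN : Odd N) (c : ℤ) (h3 : 3 ∣ N → ¬ (3 : ℤ) ∣ c - 2) :
    ∃ g : ℕ, Nat.Coprime g N ∧ ∀ ℓ : ℕ, ℓ.Prime → ℓ ∣ N →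
      (g : ZMod ℓ) ≠ 0 ∧ (g : ZMod ℓ) ≠ 1 ∧ (g : ZMod ℓ) ≠ (c : ZMod ℓ) := by
  classical
  let a : ℕ → ℕ := fun ℓ ↦ if (ℓ : ℤ) ∣ c - 2 then 3 else 2
  have hs : ∀ ℓ ∈ N.primeFactors, (id ℓ : ℕ) ≠ 0 := fun ℓ hℓ ↦ (Nat.prime_of_mem_primeFactors hℓ).ne_zero
  have pp : Set.Pairwise (N.primeFactors : Set ℕ) (Nat.Coprime on id) := by
    intro ℓ hℓ ℓ' hℓ' hne
    exact (Nat.coprime_primes (Nat.prime_of_mem_primeFactors hℓ) (Nat.prime_of_mem_primeFactors hℓ')).mpr hne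
  obtain ⟨g, hg⟩ := Nat.chineseRemainderOfFinset a id N.primeFactors hs pp
  have hN0 : N ≠ 0 := hN.pos.ne'
  have hres : ∀ ℓ : ℕ, ℓ.Prime → ℓ ∣ N → (g : ZMod ℓ) = (a ℓ : ZMod ℓ) := by
    intro ℓ hℓ hℓN
    exact (ZMod.natCast_eq_natCast_iff _ _ _).mpr (hg ℓ (Nat.mem_primeFactors.mpr ⟨hℓ, hℓN, hN0⟩))
  have key : ∀ ℓ : ℕ, ℓ.Prime → ℓ ∣ N → (g : ZMod ℓ) ≠ 0 ∧ (g : ZMod ℓ) ≠ 1 ∧ (g : ZMod ℓ) ≠ (c : ZMod ℓ) := by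
    intro ℓ hℓ hℓN
    haveI := Fact.mk hℓ
    have hℓ2 : ℓ ≠ 2 := by
      rintro rfl; exact (Nat.not_even_iff_odd.mpr hN) (even_iff_two_dvd.mpr hℓN)
    have hℓ3 : 3 ≤ ℓ := by have := hℓ.two_le; omega
    have n2 : ((2 : ℕ) : ZMod ℓ) ≠ 0 := by
      rw [Ne, ZMod.natCast_eq_zero_iff]; intro h; have := Nat.le_of_dvd (by norm_num) h; omega
    have n1 : ((2 : ℕ) : ZMod ℓ) ≠ 1 := by
      intro h
      have : ((1 : ℕ) : ZMod ℓ) = 0 := by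
        have e : ((2 : ℕ) : ZMod ℓ) - 1 = 0 := by rw [h, sub_self]
        push_cast at e ⊢; linear_combination e
      rw [ZMod.natCast_eq_zero_iff] at this
      exact hℓ.one_lt.ne' (Nat.dvd_one.mp this)
    rw [hres ℓ hℓ hℓN]
    by_cases hc : (ℓ : ℤ) ∣ c - 2
    · have ha : a ℓ = 3 := if_pos hc
      have hℓ3' : ℓ ≠ 3 := by
        rintro rfl; exact h3 hℓN hc
      have hc2 : (c : ZMod ℓ) = 2 := by
        have := (ZMod.intCast_zmod_eq_zero_iff_dvd (c - 2) ℓ).mpr hc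
        push_cast at this; linear_combination this
      rw [ha, hc2]
      refine ⟨?_, ?_, ?_⟩
      · rw [Ne, ZMod.natCast_eq_zero_iff]
        intro h; exact hℓ3' ((Nat.prime_dvd_prime_iff_eq hℓ Nat.prime_three).mp h)
      · intro h
        have : ((2 : ℕ) : ZMod ℓ) = 0 := by
          have e : ((3 : ℕ) : ZMod ℓ) - 1 = 0 := by rw [h, sub_self]
          push_cast at e ⊢; linear_combination e
        exact n2 this
      · intro h
        have : ((1 : ℕ) : ZMod ℓ) = 0 := by
          have e : ((3 : ℕ) : ZMod ℓ) - 2 = 0 := by rw [h, sub_self]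
          push_cast at e ⊢; linear_combination e
        rw [ZMod.natCast_eq_zero_iff] at this
        exact hℓ.one_lt.ne' (Nat.dvd_one.mp this)
    · have ha : a ℓ = 2 := if_neg hc
      rw [ha]
      refine ⟨n2, n1, ?_⟩
      intro h
      apply hc
      rw [← ZMod.intCast_zmod_eq_zero_iff_dvd]
      push_cast at h ⊢
      rw [← h, sub_self]
  refine ⟨g, ?_, key⟩
  refine Nat.coprime_of_dvd fun k hk hkg hkN ↦ ?_
  exact (key k hk hkN).1 ((ZMod.natCast_eq_zero_iff g k).mpr hkg)

/-! ## §2. The product rule off the classes `u ≡ 1 (mod ℓ)` -/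

/-- **`F(uv) = F(u) + F(v)` when `u ≢ 1` modulo every prime of `N`** (`N` odd): for `b = −1` elements `β₁, β₂, β₃` with
`d(β₃) ≡ d(β₁) d(β₂)`: `χ β₁ + χ β₂ + χ β₃ = 0`. [cite: Pollack2003, Conj. 6.3] -/
theorem chi_add_chi_add_chi_eq_zero_odd_of_ne_one (hN : Odd N)
    (hadd : ∀ γ δ : Gamma0 N, χ (γ * δ) = χ γ + χ δ)
    (hsmall : ∀ γ : Gamma0 N, ((γ : SL(2, ℤ)) 0 0 + (γ : SL(2, ℤ)) 1 1).natAbs ≤ 2 → χ γ = 0)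
    (hkill : ∀ γ : Gamma0 N, (∃ k : ℕ, 1 ≤ k ∧ ((γ : SL(2, ℤ)) 1 1).natAbs = 4 ^ k) → χ γ = 0)
    {β₁ β₂ β₃ : Gamma0 N} (hb1 : (β₁ : SL(2, ℤ)) 0 1 = -1) (hb2 : (β₂ : SL(2, ℤ)) 0 1 = -1)
    (hb3 : (β₃ : SL(2, ℤ)) 0 1 = -1)
    (hu1 : ∀ ℓ : ℕ, ℓ.Prime → ℓ ∣ N → ((((β₁ : SL(2, ℤ)) 1 1 : ℤ) : ZMod ℓ)) ≠ 1)
    (h3 : ((((β₃ : SL(2, ℤ)) 1 1 : ℤ) : ZMod N)) =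
      ((((β₁ : SL(2, ℤ)) 1 1 : ℤ) : ZMod N)) * ((((β₂ : SL(2, ℤ)) 1 1 : ℤ) : ZMod N))) :
    χ β₁ + χ β₂ + χ β₃ = 0 := by
  haveI : NeZero N := ⟨hN.pos.ne'⟩
  obtain ⟨K, -, hrel⟩ := TriangleN.chi_add_chi_add_chi_eq_zero_levelN hN hadd hsmall hkill hb1 hb2 hu1
  set u : ZMod N := ((((β₁ : SL(2, ℤ)) 1 1 : ℤ) : ZMod N)) with hu_def
  set v : ZMod N := ((((β₂ : SL(2, ℤ)) 1 1 : ℤ) : ZMod N)) with hv_def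
  have huv : IsUnit (u * v) := (isUnit_gamma0_apply_one_one β₁).mul (isUnit_gamma0_apply_one_one β₂)
  have h4 : IsUnit ((4 : ZMod N)) := isUnit_four_zmod hN
  have hinvu : IsUnit ((huv.unit⁻¹ : (ZMod N)ˣ) : ZMod N) := Units.isUnit _
  obtain ⟨β₃', hb3', hd3'⟩ := exists_b_neg_one_of_isUnit ((h4.pow K).mul hinvu)
  obtain ⟨β₃'', hb3'', hd3''⟩ := exists_b_neg_one_of_isUnit hinvu
  have hrel' := hrel β₃' hb3' (by
    rw [hd3', mul_comm ((4 : ZMod N) ^ K), ← mul_assoc, IsUnit.mul_val_inv, one_mul])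
  have e1 : χ β₃' = χ β₃'' :=
    chi_eq_of_b_neg_one_of_d_eq_four_pow_mul_odd hN hadd hsmall hkill K hb3' hb3'' (by rw [hd3', hd3''])
  have e2 : χ β₃'' = χ β₃ :=
    chi_eq_of_b_neg_one_of_mul_d_eq_one_odd hN hadd hsmall hkill hb3'' hb3 (by rw [hd3'', h3, IsUnit.val_inv_mul])
  rw [← e2, ← e1]; exact hrel'

/-! ## §3. The product rule for all units -/

/-- Residues mod a prime `ℓ ∣ N` of `d`-entries, from identities in `ZMod N`. [folklore] -/
theorem TriangleN.castHom_apply_one_one_dvd {ℓ : ℕ} (hℓN : ℓ ∣ N) (β : Gamma0 N) :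
    ZMod.castHom hℓN (ZMod ℓ) ((((β : SL(2, ℤ)) 1 1 : ℤ) : ZMod N)) = ((((β : SL(2, ℤ)) 1 1 : ℤ) : ZMod ℓ)) :=
  map_intCast _ _

/-- The product rule for all units, assuming `d(β₂) ≢ 2 (mod 3)` when `3 ∣ N` (removed below by evenness). -/
theorem chi_add_chi_add_chi_eq_zero_odd_aux (hN : Odd N)
    (hadd : ∀ γ δ : Gamma0 N, χ (γ * δ) = χ γ + χ δ)
    (hsmall : ∀ γ : Gamma0 N, ((γ : SL(2, ℤ)) 0 0 + (γ : SL(2, ℤ)) 1 1).natAbs ≤ 2 → χ γ = 0)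
    (hkill : ∀ γ : Gamma0 N, (∃ k : ℕ, 1 ≤ k ∧ ((γ : SL(2, ℤ)) 1 1).natAbs = 4 ^ k) → χ γ = 0)
    {β₁ β₂ β₃ : Gamma0 N} (hb1 : (β₁ : SL(2, ℤ)) 0 1 = -1) (hb2 : (β₂ : SL(2, ℤ)) 0 1 = -1)
    (hb3 : (β₃ : SL(2, ℤ)) 0 1 = -1)
    (h3N : 3 ∣ N → ¬ (3 : ℤ) ∣ (β₂ : SL(2, ℤ)) 1 1 - 2)
    (h3 : ((((β₃ : SL(2, ℤ)) 1 1 : ℤ) : ZMod N)) =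
      ((((β₁ : SL(2, ℤ)) 1 1 : ℤ) : ZMod N)) * ((((β₂ : SL(2, ℤ)) 1 1 : ℤ) : ZMod N))) :
    χ β₁ + χ β₂ + χ β₃ = 0 := by
  haveI : NeZero N := ⟨hN.pos.ne'⟩
  set x : ZMod N := ((((β₁ : SL(2, ℤ)) 1 1 : ℤ) : ZMod N)) with hx_def
  set y : ZMod N := ((((β₂ : SL(2, ℤ)) 1 1 : ℤ) : ZMod N)) with hy_def
  have hxu : IsUnit x := isUnit_gamma0_apply_one_one β₁
  have hyu : IsUnit y := isUnit_gamma0_apply_one_one β₂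
  -- the auxiliary unit `g`
  obtain ⟨g, hgN, hg⟩ := TriangleN.exists_coprime_avoiding hN ((β₂ : SL(2, ℤ)) 1 1) h3N
  have hgu : IsUnit ((g : ℕ) : ZMod N) := (ZMod.isUnit_iff_coprime g N).mpr hgN
  set gi : ZMod N := ((hgu.unit⁻¹ : (ZMod N)ˣ) : ZMod N) with hgi_def
  have hgiu : IsUnit gi := Units.isUnit _
  have hggi : (g : ZMod N) * gi = 1 := IsUnit.mul_val_inv hgu
  obtain ⟨βg, hbg, hdg⟩ := exists_b_neg_one_of_isUnit hgu
  obtain ⟨βyg, hbyg, hdyg⟩ := exists_b_neg_one_of_isUnit (hyu.mul hgiu)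
  obtain ⟨βxyg, hbxyg, hdxyg⟩ := exists_b_neg_one_of_isUnit ((hxu.mul hyu).mul hgiu)
  -- `g ≢ 1` and `y/g ≢ 1` modulo every prime of `N`
  have hg1 : ∀ ℓ : ℕ, ℓ.Prime → ℓ ∣ N → ((((βg : SL(2, ℤ)) 1 1 : ℤ) : ZMod ℓ)) ≠ 1 := by
    intro ℓ hℓ hℓN h
    apply (hg ℓ hℓ hℓN).2.1
    rw [← map_natCast (ZMod.castHom hℓN (ZMod ℓ)) g, ← hdg, TriangleN.castHom_apply_one_one_dvd hℓN, h]
  have hyg1 : ∀ ℓ : ℕ, ℓ.Prime → ℓ ∣ N → ((((βyg : SL(2, ℤ)) 1 1 : ℤ) : ZMod ℓ)) ≠ 1 := by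
    intro ℓ hℓ hℓN h
    apply (hg ℓ hℓ hℓN).2.2
    -- apply `castHom` to `d(βyg) * g = y`
    have e : ((((βyg : SL(2, ℤ)) 1 1 : ℤ) : ZMod N)) * (g : ZMod N) = y := by
      rw [hdyg, mul_assoc, hgi_def, IsUnit.val_inv_mul, mul_one]
    have e' := congrArg (ZMod.castHom hℓN (ZMod ℓ)) e
    rw [map_mul, TriangleN.castHom_apply_one_one_dvd hℓN, h, one_mul, map_natCast, hy_def,
      TriangleN.castHom_apply_one_one_dvd hℓN] at e'
    exact e'
  -- the three instances of §2
  have r1 := chi_add_chi_add_chi_eq_zero_odd_of_ne_one hN hadd hsmall hkill hbg hbyg hb2 hg1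
    (by rw [hdg, hdyg, mul_comm y gi, ← mul_assoc, hggi, one_mul])
  have r2 := chi_add_chi_add_chi_eq_zero_odd_of_ne_one hN hadd hsmall hkill hbg hbxyg hb3 hg1
    (by rw [hdg, hdxyg, h3, mul_comm (x * y) gi, ← mul_assoc, hggi, one_mul])
  have r3 := chi_add_chi_add_chi_eq_zero_odd_of_ne_one hN hadd hsmall hkill hbyg hb1 hbxyg hyg1
    (by rw [hdyg, hdxyg, ← hx_def]; ring)
  have c1 := CharTwo.add_self_eq_zero (χ βg)
  have c2 := CharTwo.add_self_eq_zero (χ βyg)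
  have c3 := CharTwo.add_self_eq_zero (χ βxyg)
  linear_combination r1 + r2 + r3 - c1 - c2 - c3

/-- **`F(uv) = F(u) + F(v)` for ALL units at every odd level**: for `b = −1` elements `β₁, β₂, β₃ ∈ Γ₀(N)` with
`d(β₃) ≡ d(β₁) d(β₂) (mod N)` and admissible `χ`: `χ β₁ + χ β₂ + χ β₃ = 0`. [cite: Pollack2003, Conj. 6.3] -/
theorem chi_add_chi_add_chi_eq_zero_odd (hN : Odd N)
    (hadd : ∀ γ δ : Gamma0 N, χ (γ * δ) = χ γ + χ δ)
    (hsmall : ∀ γ : Gamma0 N, ((γ : SL(2, ℤ)) 0 0 + (γ : SL(2, ℤ)) 1 1).natAbs ≤ 2 → χ γ = 0)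
    (hkill : ∀ γ : Gamma0 N, (∃ k : ℕ, 1 ≤ k ∧ ((γ : SL(2, ℤ)) 1 1).natAbs = 4 ^ k) → χ γ = 0)
    {β₁ β₂ β₃ : Gamma0 N} (hb1 : (β₁ : SL(2, ℤ)) 0 1 = -1) (hb2 : (β₂ : SL(2, ℤ)) 0 1 = -1)
    (hb3 : (β₃ : SL(2, ℤ)) 0 1 = -1)
    (h3 : ((((β₃ : SL(2, ℤ)) 1 1 : ℤ) : ZMod N)) =
      ((((β₁ : SL(2, ℤ)) 1 1 : ℤ) : ZMod N)) * ((((β₂ : SL(2, ℤ)) 1 1 : ℤ) : ZMod N))) :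
    χ β₁ + χ β₂ + χ β₃ = 0 := by
  haveI : NeZero N := ⟨hN.pos.ne'⟩
  by_cases hbad : 3 ∣ N ∧ (3 : ℤ) ∣ (β₂ : SL(2, ℤ)) 1 1 - 2
  · -- replace `β₂, β₃` by elements with `d ≡ −d(β₂)`, `−d(β₃)`
    obtain ⟨h3N, h32⟩ := hbad
    obtain ⟨γ₂, hg2, hd2⟩ := exists_b_neg_one_of_isUnit (isUnit_gamma0_apply_one_one β₂).neg
    obtain ⟨γ₃, hg3, hd3⟩ := exists_b_neg_one_of_isUnit (isUnit_gamma0_apply_one_one β₃).neg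
    have e2 : χ β₂ = χ γ₂ := (chi_eq_of_b_neg_one_of_d_eq_neg_odd hN hadd hsmall hkill hg2 hb2 hd2).symm
    have e3 : χ β₃ = χ γ₃ := (chi_eq_of_b_neg_one_of_d_eq_neg_odd hN hadd hsmall hkill hg3 hb3 hd3).symm
    -- `d(γ₂) ≡ −d(β₂) ≡ −2 ≡ 1 (mod 3)`, so `d(γ₂) ≢ 2 (mod 3)`
    have h3' : 3 ∣ N → ¬ (3 : ℤ) ∣ (γ₂ : SL(2, ℤ)) 1 1 - 2 := by
      intro _ h
      have e := congrArg (ZMod.castHom h3N (ZMod 3)) hd2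
      rw [map_neg, TriangleN.castHom_apply_one_one_dvd h3N, TriangleN.castHom_apply_one_one_dvd h3N] at e
      have a1 : ((((γ₂ : SL(2, ℤ)) 1 1 : ℤ) : ZMod 3)) = 2 := by
        have := (ZMod.intCast_zmod_eq_zero_iff_dvd _ 3).mpr h
        push_cast at this; linear_combination this
      have a2 : ((((β₂ : SL(2, ℤ)) 1 1 : ℤ) : ZMod 3)) = 2 := by
        have := (ZMod.intCast_zmod_eq_zero_iff_dvd _ 3).mpr h32
        push_cast at this; linear_combination this
      rw [a1, a2] at e
      exact absurd e (by decide)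
    rw [e2, e3]
    exact chi_add_chi_add_chi_eq_zero_odd_aux hN hadd hsmall hkill hb1 hg2 hg3 h3' (by rw [hd2, hd3, h3]; ring)
  · push Not at hbad
    exact chi_add_chi_add_chi_eq_zero_odd_aux hN hadd hsmall hkill hb1 hb2 hb3 hbad h3

/-! ## §4. The node at an odd level ⟺ «admissible characters vanishing on `B₁` vanish» -/

/-- **(G′)_N from (G‴)_N at every odd level.** If every additive `χ' : Γ₀(N) → 𝔽₂` killing the small-trace elements, the
`4^k`-elements AND every `b = −1` element vanishes identically, then `CuspSpanEvenAtTwo N`: for an admissible `χ` the `B₁`-character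
`F` is multiplicative (§3) and `χ + F ∘ d̄` satisfies the hypothesis. [cite: Pollack2003, Conj. 6.3] [cite: Rademacher1929, §1] -/
theorem cuspSpanTrace_of_forall_b1_odd (hN : Odd N)
    (hG3 : ∀ χ' : Gamma0 N → ZMod 2,
      (∀ γ δ : Gamma0 N, χ' (γ * δ) = χ' γ + χ' δ) →
      (∀ γ : Gamma0 N, ((γ : SL(2, ℤ)) 0 0 + (γ : SL(2, ℤ)) 1 1).natAbs ≤ 2 → χ' γ = 0) →
      (∀ γ : Gamma0 N, (∃ k : ℕ, 1 ≤ k ∧ ((γ : SL(2, ℤ)) 1 1).natAbs = 4 ^ k) → χ' γ = 0) →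
      (∀ β : Gamma0 N, (β : SL(2, ℤ)) 0 1 = -1 → χ' β = 0) → ∀ γ : Gamma0 N, χ' γ = 0) :
    ∀ χ : Gamma0 N → ZMod 2,
      (∀ γ δ : Gamma0 N, χ (γ * δ) = χ γ + χ δ) →
      (∀ γ : Gamma0 N, ((γ : SL(2, ℤ)) 0 0 + (γ : SL(2, ℤ)) 1 1).natAbs ≤ 2 → χ γ = 0) →
      (∀ γ : Gamma0 N, (∃ k : ℕ, 1 ≤ k ∧ ((γ : SL(2, ℤ)) 1 1).natAbs = 4 ^ k) → χ γ = 0) →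
      ∃ ψ : ZMod N → ZMod 2, (∀ x y : ZMod N, IsUnit x → IsUnit y → ψ (x * y) = ψ x + ψ y) ∧
        ∀ γ : Gamma0 N, χ γ = ψ ((((γ : SL(2, ℤ)) 1 1 : ℤ) : ZMod N)) := by
  classical
  intro χ hadd hsmall hkill
  haveI : NeZero N := ⟨hN.pos.ne'⟩
  -- the `B₁`-character
  have hex : ∀ r : ZMod N, IsUnit r → ∃ β : Gamma0 N, (β : SL(2, ℤ)) 0 1 = -1 ∧ ((((β : SL(2, ℤ)) 1 1 : ℤ) : ZMod N)) = r :=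
    fun r hr ↦ exists_b_neg_one_of_isUnit hr
  let F : ZMod N → ZMod 2 := fun r ↦ if h : IsUnit r then χ (Classical.choose (hex r h)) else 0
  have hF : ∀ β : Gamma0 N, (β : SL(2, ℤ)) 0 1 = -1 → F ((((β : SL(2, ℤ)) 1 1 : ℤ) : ZMod N)) = χ β := by
    intro β hb
    have hr : IsUnit ((((β : SL(2, ℤ)) 1 1 : ℤ) : ZMod N)) := isUnit_gamma0_apply_one_one β
    have hs := Classical.choose_spec (hex _ hr)
    simp only [F, dif_pos hr]
    exact chi_eq_of_apply_zero_one_eq_neg_one hadd hsmall hs.1 hb hs.2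
  have h1 : F 1 = 0 := by
    obtain ⟨e, he00, he01, -, he11⟩ :=
      ThetaLayerLambdaCongruenceAtTwo.exists_gamma0_entries (N := N) 1 (-1) 0 1 (by ring) (dvd_zero _)
    have e11 : ((((e : SL(2, ℤ)) 1 1 : ℤ) : ZMod N)) = 1 := by rw [he11]; push_cast; rfl
    rw [← e11, hF e he01]
    exact hsmall e (by rw [he00, he11]; decide)
  -- multiplicativity (§3)
  have hmult : ∀ x y : ZMod N, IsUnit x → IsUnit y → F (x * y) = F x + F y := by
    intro x y hx hy
    obtain ⟨βx, hbx, hdx⟩ := hex x hx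
    obtain ⟨βy, hby, hdy⟩ := hex y hy
    obtain ⟨βxy, hbxy, hdxy⟩ := hex (x * y) (hx.mul hy)
    have hsum := chi_add_chi_add_chi_eq_zero_odd hN hadd hsmall hkill hbx hby hbxy (by rw [hdxy, hdx, hdy])
    rw [← hdxy, ← hdx, ← hdy, hF βx hbx, hF βy hby, hF βxy hbxy]
    rw [add_eq_zero_iff_eq_neg, ZMod.neg_eq_self_mod_two] at hsum
    exact hsum.symm
  have hpow : ∀ (x : ZMod N), IsUnit x → ∀ n : ℕ, F (x ^ n) = n * F x := by
    intro x hx n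
    induction n with
    | zero => rw [pow_zero, h1]; simp
    | succ n ih => rw [pow_succ, hmult _ _ (hx.pow n) hx, ih]; push_cast; ring
  refine ⟨F, hmult, ?_⟩
  -- `χ' = χ + F ∘ d̄`
  let χ' : Gamma0 N → ZMod 2 := fun γ ↦ χ γ + F ((((γ : SL(2, ℤ)) 1 1 : ℤ) : ZMod N))
  have hadd' : ∀ γ δ : Gamma0 N, χ' (γ * δ) = χ' γ + χ' δ := by
    intro γ δ
    simp only [χ']
    rw [cast_mul_apply_one_one, hmult _ _ (isUnit_gamma0_apply_one_one γ) (isUnit_gamma0_apply_one_one δ), hadd]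
    ring
  have hS : F (-1) = 0 := by
    obtain ⟨β₀, hb0, hd0⟩ := hex 1 isUnit_one
    obtain ⟨βm, hbm, hdm⟩ := hex (-1) isUnit_one.neg
    rw [← hdm, hF βm hbm, ← chi_eq_of_b_neg_one_of_mul_d_eq_neg_one hadd hsmall hb0 hbm (by rw [hd0, hdm]; ring),
      ← hF β₀ hb0, hd0, h1]
  have hnil : ∀ ε : ZMod N, ε * ε = 0 → F (1 + ε) = 0 := by
    intro ε hε
    have hu : IsUnit (1 + ε) := IsUnit.of_mul_eq_one (1 - ε) (by linear_combination -hε)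
    have e1 : F ((1 + ε) ^ N) = (N : ZMod 2) * F (1 + ε) := hpow _ hu N
    rw [TriangleN.one_add_pow_of_sq_zero ε hε, ZMod.natCast_self, zero_mul, add_zero, h1,
      (ZMod.natCast_eq_one_iff_odd.mpr hN), one_mul] at e1
    exact e1.symm
  have hsmall' : ∀ γ : Gamma0 N, ((γ : SL(2, ℤ)) 0 0 + (γ : SL(2, ℤ)) 1 1).natAbs ≤ 2 → χ' γ = 0 := by
    intro γ ht
    simp only [χ']
    rw [hsmall γ ht, zero_add]
    set d : ZMod N := ((((γ : SL(2, ℤ)) 1 1 : ℤ) : ZMod N)) with hd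
    set t : ℤ := (γ : SL(2, ℤ)) 0 0 + (γ : SL(2, ℤ)) 1 1 with htdef
    have hsq : d * d = (t : ZMod N) * d - 1 := cast_apply_one_one_sq γ
    have hcases : t = -2 ∨ t = -1 ∨ t = 0 ∨ t = 1 ∨ t = 2 := by omega
    have hell : ∀ t' : ℤ, t'.natAbs ≤ 1 → d * d + t' * d + 1 = 0 → F d = 0 := by
      intro t' ht' h
      obtain ⟨β, hb, hdb⟩ := hex d (isUnit_gamma0_apply_one_one γ)
      rw [← hdb, hF β hb]
      refine chi_eq_zero_of_b_neg_one_of_elliptic hadd hsmall β hb ((γ : SL(2, ℤ)) 1 1) t' ht' ?_ (by rw [hdb])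
      rw [← ZMod.intCast_zmod_eq_zero_iff_dvd]
      push_cast
      rw [← hd]; exact h
    rcases hcases with h | h | h | h | h <;> rw [h] at hsq <;> push_cast at hsq
    · have hε : (-d - 1) * (-d - 1) = 0 := by linear_combination hsq
      have e : d = (-1) * (1 + (-d - 1)) := by ring
      rw [e, hmult _ _ isUnit_one.neg (IsUnit.of_mul_eq_one (1 - (-d - 1)) (by linear_combination -hε)), hS,
        hnil _ hε, add_zero]
    · exact hell 1 (by decide) (by push_cast; linear_combination hsq)
    · exact hell 0 (by decide) (by push_cast; linear_combination hsq)
    · exact hell (-1) (by decide) (by push_cast; linear_combination hsq)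
    · have hε : (d - 1) * (d - 1) = 0 := by linear_combination hsq
      have e : d = 1 + (d - 1) := by ring
      rw [e]; exact hnil _ hε
  have hkill' : ∀ γ : Gamma0 N, (∃ k : ℕ, 1 ≤ k ∧ ((γ : SL(2, ℤ)) 1 1).natAbs = 4 ^ k) → χ' γ = 0 := by
    rintro γ ⟨k, hk, hγ⟩
    simp only [χ']
    rw [hkill γ ⟨k, hk, hγ⟩, zero_add]
    obtain ⟨β, hb, hdb⟩ := hex _ (isUnit_gamma0_apply_one_one γ)
    rw [← hdb, hF β hb]
    -- `d(γ) = ±4^k`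
    rcases Int.natAbs_eq_iff.mp hγ with hε | hε
    · exact chi_eq_zero_of_b_neg_one_of_d_eq_four_pow hadd hsmall hkill β hb k hk 1 (by simp)
        (by rw [hdb, hε]; push_cast; ring)
    · exact chi_eq_zero_of_b_neg_one_of_d_eq_four_pow hadd hsmall hkill β hb k hk (-1) (by simp)
        (by rw [hdb, hε]; push_cast; ring)
  have hB' : ∀ β : Gamma0 N, (β : SL(2, ℤ)) 0 1 = -1 → χ' β = 0 := by
    intro β hb
    simp only [χ']
    rw [hF β hb]
    exact CharTwo.add_self_eq_zero _
  have hzero := hG3 χ' hadd' hsmall' hkill' hB'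
  intro γ
  have h := hzero γ
  simp only [χ'] at h
  have e : χ γ = -F ((((γ : SL(2, ℤ)) 1 1 : ℤ) : ZMod N)) := by linear_combination h
  rw [e, ZMod.neg_eq_self_mod_two]

/-- **`CuspSpanEvenAtTwo N` ⟸ (G‴)_N** at every odd level. [cite: Pollack2003, Conj. 6.3] -/
theorem cuspSpanEvenAtTwo_of_forall_b1_odd (hN : Odd N) [NeZero N]
    (hG3 : ∀ χ' : Gamma0 N → ZMod 2,
      (∀ γ δ : Gamma0 N, χ' (γ * δ) = χ' γ + χ' δ) →
      (∀ γ : Gamma0 N, ((γ : SL(2, ℤ)) 0 0 + (γ : SL(2, ℤ)) 1 1).natAbs ≤ 2 → χ' γ = 0) →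
      (∀ γ : Gamma0 N, (∃ k : ℕ, 1 ≤ k ∧ ((γ : SL(2, ℤ)) 1 1).natAbs = 4 ^ k) → χ' γ = 0) →
      (∀ β : Gamma0 N, (β : SL(2, ℤ)) 0 1 = -1 → χ' β = 0) → ∀ γ : Gamma0 N, χ' γ = 0) :
    CuspSpanEvenAtTwo N :=
  cuspSpanEvenAtTwo_of_cuspSpanTrace (cuspSpanTrace_of_forall_b1_odd hN hG3)

/-- **(G‴)_N ⟸ the trace form (G″)_N** (any level): if every admissible `χ` is `ψ ∘ d̄` with `ψ` multiplicative on units, then an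
admissible `χ` vanishing on `B₁` vanishes — `ψ(u) = χ(β_u) = 0` for every unit `u`. [folklore] -/
theorem forall_b1_of_cuspSpanTrace [NeZero N]
    (hG : ∀ χ : Gamma0 N → ZMod 2,
      (∀ γ δ : Gamma0 N, χ (γ * δ) = χ γ + χ δ) →
      (∀ γ : Gamma0 N, ((γ : SL(2, ℤ)) 0 0 + (γ : SL(2, ℤ)) 1 1).natAbs ≤ 2 → χ γ = 0) →
      (∀ γ : Gamma0 N, (∃ k : ℕ, 1 ≤ k ∧ ((γ : SL(2, ℤ)) 1 1).natAbs = 4 ^ k) → χ γ = 0) →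
      ∃ ψ : ZMod N → ZMod 2, (∀ x y : ZMod N, IsUnit x → IsUnit y → ψ (x * y) = ψ x + ψ y) ∧
        ∀ γ : Gamma0 N, χ γ = ψ ((((γ : SL(2, ℤ)) 1 1 : ℤ) : ZMod N))) :
    ∀ χ' : Gamma0 N → ZMod 2,
      (∀ γ δ : Gamma0 N, χ' (γ * δ) = χ' γ + χ' δ) →
      (∀ γ : Gamma0 N, ((γ : SL(2, ℤ)) 0 0 + (γ : SL(2, ℤ)) 1 1).natAbs ≤ 2 → χ' γ = 0) →
      (∀ γ : Gamma0 N, (∃ k : ℕ, 1 ≤ k ∧ ((γ : SL(2, ℤ)) 1 1).natAbs = 4 ^ k) → χ' γ = 0) →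
      (∀ β : Gamma0 N, (β : SL(2, ℤ)) 0 1 = -1 → χ' β = 0) → ∀ γ : Gamma0 N, χ' γ = 0 := by
  intro χ' hadd hsmall hkill hB γ
  obtain ⟨ψ, -, hψ⟩ := hG χ' hadd hsmall hkill
  obtain ⟨β, hb, hd⟩ := exists_b_neg_one_of_isUnit (isUnit_gamma0_apply_one_one γ)
  rw [hψ γ, ← hd, ← hψ β, hB β hb]

end Summit.BirchSwinnertonDyer.BirchSwinnertonDyer.Theorems.SignedMuAtTwo

end
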